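import Summits.BirchSwinnertonDyer.BirchSwinnertonDyer.Theorems.ClassRecordThreeEulerHalvesAtThreeCartanCoverReduction
import Summits.BirchSwinnertonDyer.BirchSwinnertonDyer.Theorems.ClassRecordThreeEulerHalvesAtThreeCartanTransportNormOneLift
import HarnessLib

/-!
# (M0) at ODD Cartan places — `redHom : ι(O₀'¹) → GL₂(𝔽_q)` is onto `SL₂(𝔽_q)` (strong approximation, lattice form)

Crux `CartanOnePlaceDegreeLawAtThree` (NUM, stmt-BirchSwinnertonDyer-24801), lines `lattice` ∕ `charext`: the print input (M0)
`CartanCover.Charext.StrongApproxAtCartanPlace` (Eichler–Kneser strong approximation at the Cartan place) asks that every determinant-one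
`g ∈ GL₂(𝔽_q)` be `R.redHom γ` for a norm-one unit `γ` of the cover order `O₀' = coverOrder X q`. PROVED here for every ODD Cartan prime
`q ∈ C` (`redHom_surjective_of_odd`; the saturation clause (D4) only ever meets `q ≡ 1 (mod 3)`), from the tree's lattice form of Kneser's theorem
`QuaternionAlgebra.exists_mem_mul_star_eq_one` exactly as in `CartanTransport.NormOneLift.exists_normOne_residues`: the residue-LINE lattice
`Λ = {x ∈ O₀' : red x ∈ ℤ·g}` is full (`q O₀' ⊆ Λ ⊆ O₀'`), has the local point `x₀` (`red x₀ = g`, `nrd x₀ ≡ det g = 1 (mod q)`, `q` odd) at `q` and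
`1 ∈ Λ₍ₚ₎` at `p ≠ q` (`q·1 ∈ Λ`); a norm-one `u ∈ Λ` has `red u = c g` with `c² = 1`, so `± u` is a norm-one unit of `O₀'` reducing to `g`.
At `q = 2` a `(mod 16)` refinement of the local point would be needed; not done here. BSD is proved for no curve.
[cite: VignerasLNM800, Ch. III §4 Thm. 4.3 and §5 Cor. 5.7] [cite: Voight2021, Thm. 28.5.3]
-/

set_option linter.dupNamespace false
set_option autoImplicit false

noncomputable section

open scoped TensorProduct NumberField Pointwise Quaternion MatrixGroups

namespace Summit.BirchSwinnertonDyer.BirchSwinnertonDyer.Theorems.CartanCover.CoverReduction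

open Literature.NumberTheory.Automorphic
open Summit.BirchSwinnertonDyer.BirchSwinnertonDyer.Theorems.CartanTransport

variable {D M : ℕ} {C : Finset ℕ} {X : CartanLevelCurveData D M C} {q : ℕ} [Fact q.Prime]
  (R : CoverReduction X q)

/-- `red` of an integer multiple. [folklore] -/
theorem red_zsmul (m : ℤ) (x : coverSubring X q) : R.red (m • x) = (m : ZMod q) • R.red x := by
  rw [zsmul_eq_mul, map_mul, map_intCast, ← smul_eq_mul, Int.cast_smul_eq_zsmul]
  exact (Int.cast_smul_eq_zsmul (ZMod q) m (R.red x)).symm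

/-- `red (q • x) = 0`. [folklore] -/
theorem red_natCast_smul_eq_zero (x : coverSubring X q) : R.red (((q : ℕ) : ℤ) • x) = 0 := by
  rw [red_zsmul, Int.cast_natCast, ZMod.natCast_self, zero_smul]

/-- `tr`-free determinant transfer: `det (red x) = nrd x (mod q)` in the form `nrd x = 1 + q k` when `det (red x) = 1`. [folklore] -/
theorem exists_reducedNorm_eq_one_add (x : coverSubring X q) (hx : (R.red x).det = 1) :
    ∃ k : ℤ, reducedNorm ℚ X.B (x : X.B) = 1 + (q : ℚ) * k := by
  obtain ⟨n, hn, hdet⟩ := R.det_red x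
  have hn1 : ((n - 1 : ℤ) : ZMod q) = 0 := by rw [Int.cast_sub, Int.cast_one, ← hdet, hx, sub_self]
  obtain ⟨k, hk⟩ := (ZMod.intCast_zmod_eq_zero_iff_dvd (n - 1) q).mp hn1
  refine ⟨k, ?_⟩
  rw [hn]
  have : n = 1 + (q : ℤ) * k := by linarith
  exact_mod_cast this

/-- **The residue-line lattice** `Λ_g = {x ∈ O₀' : red x ∈ ℤ · g}` as a `ℤ`-submodule of `X.B`. [folklore] -/
theorem exists_residueLineLattice (g : Matrix (Fin 2) (Fin 2) (ZMod q)) :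
    ∃ Λ : Submodule ℤ X.B, ∀ x, x ∈ Λ ↔ ∃ hx : x ∈ coverOrder X q, ∃ k : ℤ, R.red ⟨x, hx⟩ = (k : ZMod q) • g := by
  refine ⟨{ carrier := {x | ∃ hx : x ∈ coverOrder X q, ∃ k : ℤ, R.red ⟨x, hx⟩ = (k : ZMod q) • g}
            add_mem' := ?_, zero_mem' := ?_, smul_mem' := ?_ }, fun x => Iff.rfl⟩
  · rintro x y ⟨hx, k, hk⟩ ⟨hy, l, hl⟩
    refine ⟨(coverOrder X q).add_mem hx hy, k + l, ?_⟩
    have : (⟨x + y, (coverOrder X q).add_mem hx hy⟩ : coverSubring X q) = ⟨x, hx⟩ + ⟨y, hy⟩ := rfl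
    rw [this, map_add, hk, hl, Int.cast_add, add_smul]
  · refine ⟨(coverOrder X q).zero_mem, 0, ?_⟩
    have : (⟨0, (coverOrder X q).zero_mem⟩ : coverSubring X q) = 0 := rfl
    rw [this, map_zero, Int.cast_zero, zero_smul]
  · rintro m x ⟨hx, k, hk⟩
    refine ⟨(coverOrder X q).smul_mem m hx, m * k, ?_⟩
    have : (⟨m • x, (coverOrder X q).smul_mem m hx⟩ : coverSubring X q) = m • ⟨x, hx⟩ := rfl
    rw [this, red_zsmul, hk, smul_smul, Int.cast_mul]

omit [Fact q.Prime] in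
/-- A norm-one element of the cover order gives a norm-one unit `γ ∈ ι(O₀'¹)` with `ι u = γ` (so `unitLift γ = u`). [folklore] -/
theorem exists_coverUnits_of_reducedNorm_eq_one {u : X.B} (hu : u ∈ coverOrder X q) (hnu : reducedNorm ℚ X.B u = 1) :
    ∃ γ : coverUnits X q, unitLift γ = ⟨u, hu⟩ := by
  have hO' : Brandt.IsOrder X.B (coverOrder X q) := isOrder_coverOrder X q
  set ub : X.B := standardInvolution ℚ X.B u with hub
  have hubO : ub ∈ coverOrder X q := hO'.standardInvolution_mem hu
  have hubu : ub * u = 1 := by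
    rw [hub, IsQuaternionAlgebra.standardInvolution_mul (K := ℚ), hnu, map_one]
  have hdet1 : (X.ι u).det = 1 := by rw [AlgHom.det_eq_reducedNorm X.ι, hnu, map_one]
  set γ₀ : GL (Fin 2) ℝ := Matrix.GeneralLinearGroup.mkOfDetNeZero (X.ι u)
    (by rw [hdet1]; exact one_ne_zero) with hγ₀
  have hγval : (γ₀ : Matrix (Fin 2) (Fin 2) ℝ) = X.ι u := rfl
  have hγinv : ((γ₀⁻¹ : GL (Fin 2) ℝ) : Matrix (Fin 2) (Fin 2) ℝ) = X.ι ub := by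
    rw [Matrix.coe_units_inv, hγval]
    exact Matrix.inv_eq_left_inv (by rw [← map_mul, hubu, map_one])
  have hmem : γ₀ ∈ coverUnits X q := by
    refine ⟨⟨u, hu, hγval.symm⟩, ⟨ub, hubO, hγinv.symm⟩, ?_⟩
    ext
    rw [Matrix.GeneralLinearGroup.val_det_apply, hγval, hdet1, Units.val_one]
  exact ⟨⟨γ₀, hmem⟩, unitLift_eq_of_ι_eq ⟨γ₀, hmem⟩ hu hγval.symm⟩

/-- **(M0) AT AN ODD CARTAN PLACE — `redHom` is onto `SL₂(𝔽_q)`.** For an odd prime `q ∈ C`, a reduction datum `R` of the cover order and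
`g ∈ GL₂(𝔽_q)` of determinant `1`, some norm-one unit `γ ∈ ι(O₀'¹)` has `R.redHom γ = g`. Kneser's strong approximation in the lattice form of the tree
(`QuaternionAlgebra.exists_mem_mul_star_eq_one`) applied to the residue-line lattice `Λ_g`, transported to an integral model `ℍ[ℚ,a,b]` of `X.B` as in
`CartanTransport.NormOneLift.exists_normOne_residues`. [cite: VignerasLNM800, Ch. III §4 Thm. 4.3 and §5 Cor. 5.7] [cite: Voight2021, Thm. 28.5.3] -/
theorem redHom_surjective_of_odd (hq2 : q ≠ 2) (g : GL (Fin 2) (ZMod q))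
    (hg : Matrix.det (g : Matrix (Fin 2) (Fin 2) (ZMod q)) = 1) : ∃ γ : coverUnits X q, R.redHom γ = g := by
  classical
  have hqp : q.Prime := Fact.out
  have hO' : Brandt.IsOrder X.B (coverOrder X q) := isOrder_coverOrder X q
  obtain ⟨Λ, hΛ⟩ := R.exists_residueLineLattice (g : Matrix (Fin 2) (Fin 2) (ZMod q))
  have hΛle : Λ ≤ coverOrder X q := fun x hx => ((hΛ x).mp hx).1
  -- `q · O₀' ⊆ Λ`
  have hqmem : ∀ x ∈ coverOrder X q, ((q : ℕ) : ℤ) • x ∈ Λ := by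
    intro x hx
    refine (hΛ _).mpr ⟨(coverOrder X q).smul_mem _ hx, 0, ?_⟩
    have : (⟨((q : ℕ) : ℤ) • x, (coverOrder X q).smul_mem _ hx⟩ : coverSubring X q) = ((q : ℕ) : ℤ) • ⟨x, hx⟩ := rfl
    rw [this, red_natCast_smul_eq_zero, Int.cast_zero, zero_smul]
  have hq0 : ((q : ℕ) : ℤ) ≠ 0 := by exact_mod_cast hqp.ne_zero
  have hΛfull : IsFullLattice X.B Λ := isFullLattice_of_between hO'.isFullLattice hΛle hq0 hqmem
  -- an integral model `H = ℍ[ℚ,a,b]` of `X.B`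
  obtain ⟨a, b, ha, hb, ⟨e⟩⟩ :=
    QuaternionAlgebra.exists_algEquiv_quaternionAlgebra_integers (K := ℚ) (D := X.B)
  have hinjO := FaithfulSMul.algebraMap_injective (𝓞 ℚ) ℚ
  haveI : IsQuaternionAlgebra ℚ ℍ[ℚ,algebraMap (𝓞 ℚ) ℚ a,algebraMap (𝓞 ℚ) ℚ b] :=
    QuaternionAlgebra.isQuaternionAlgebra_holds ((map_ne_zero_iff _ hinjO).mpr ha)
      ((map_ne_zero_iff _ hinjO).mpr hb)
  set ΛH : Submodule ℤ ℍ[ℚ,algebraMap (𝓞 ℚ) ℚ a,algebraMap (𝓞 ℚ) ℚ b] :=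
    Λ.map (e.toRingEquiv.toAddEquiv.toIntLinearEquiv :
      X.B →ₗ[ℤ] ℍ[ℚ,algebraMap (𝓞 ℚ) ℚ a,algebraMap (𝓞 ℚ) ℚ b]) with hΛH
  have hΛHfull : IsFullLattice _ ΛH := hΛfull.map_ringEquiv e.toRingEquiv
  have hdef : ¬ IsTotallyDefinite ℚ ℍ[ℚ,algebraMap (𝓞 ℚ) ℚ a,algebraMap (𝓞 ℚ) ℚ b] := by
    obtain ⟨v⟩ : Nonempty (NumberField.InfinitePlace ℚ) := inferInstance
    exact fun h => h v (isSplitAtInfinite_of_algHom_real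
      (X.ι.comp (e.symm : ℍ[ℚ,algebraMap (𝓞 ℚ) ℚ a,algebraMap (𝓞 ℚ) ℚ b] →ₐ[ℚ] X.B)) v)
  have hmemH : ∀ z : X.B, e z ∈ ΛH ↔ z ∈ Λ := fun z => by
    rw [hΛH, mem_map_ringEquiv_iff]
    change e.symm (e z) ∈ Λ ↔ z ∈ Λ
    rw [e.symm_apply_apply]
  -- local points of norm `≡ 1 (mod 8p)`
  have hloc : ∀ p : ℕ, p.Prime → ∃ z ∈ localAt p ΛH, ∃ d : ℚ, padicNorm p d < 1 ∧
      z * star z = algebraMap ℚ _ (1 + 8 * d) := by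
    intro p hp
    haveI : Fact p.Prime := ⟨hp⟩
    by_cases hpq : p = q
    · subst hpq
      -- `x₀ ∈ O₀'` with `red x₀ = g`
      obtain ⟨x₀, hx₀⟩ := R.red_surjective (g : Matrix (Fin 2) (Fin 2) (ZMod p))
      have hzΛ : (x₀ : X.B) ∈ Λ := by
        refine (hΛ _).mpr ⟨x₀.2, 1, ?_⟩
        rw [Int.cast_one, one_smul]
        exact hx₀
      obtain ⟨k, hk⟩ := R.exists_reducedNorm_eq_one_add x₀ (by rw [hx₀, hg])
      have h8 : ¬ p ∣ 8 := fun h8 =>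
        hq2 ((Nat.prime_dvd_prime_iff_eq hp Nat.prime_two).mp (hp.dvd_of_dvd_pow (show p ∣ 2 ^ 3 from h8)))
      have h8' : padicNorm p (8 : ℚ) = 1 := by exact_mod_cast (padicNorm.nat_eq_one_iff (p := p) 8).mpr h8
      refine ⟨e x₀, le_localAt p ΛH ((hmemH _).mpr hzΛ), (p : ℚ) * k / 8, ?_, ?_⟩
      · calc padicNorm p ((p : ℚ) * k / 8) = (p : ℚ)⁻¹ * padicNorm p (k : ℚ) := by
              rw [padicNorm.div, padicNorm.mul, h8', div_one, padicNorm.padicNorm_p_of_prime]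
          _ ≤ (p : ℚ)⁻¹ * 1 := by gcongr; exact padicNorm.of_int k
          _ < 1 := by rw [mul_one]; exact inv_lt_one_of_one_lt₀ (by exact_mod_cast hp.one_lt)
      · rw [QuaternionAlgebra.mul_star_self_eq_algebraMap_reducedNorm ℚ (e (x₀ : X.B)), reducedNorm_algEquiv e, hk]
        congr 1
        ring
    · -- `z = 1 ∈ Λ₍ₚ₎` since `q · 1 ∈ Λ` with `p ≠ q`
      refine ⟨1, mem_localAt_iff.mpr ⟨q, hqp.ne_zero, ?_, ?_⟩, 0, by simp, by simp⟩
      · exact (Nat.coprime_primes hqp hp).mpr (Ne.symm hpq)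
      · have h1 := (hmemH _).mpr (hqmem 1 hO'.one_mem)
        rwa [map_zsmul, map_one] at h1
  -- a norm-one point of `Λ`
  obtain ⟨xH, hxΛ, hx1⟩ := QuaternionAlgebra.exists_mem_mul_star_eq_one a b ha hb hdef hΛHfull hloc
  set x : X.B := e.symm xH with hx
  have hxΛ' : x ∈ Λ := (mem_map_ringEquiv_iff e.toRingEquiv).mp hxΛ
  have hnx : reducedNorm ℚ X.B x = 1 := by
    have h := (QuaternionAlgebra.mul_star_self_eq_one_iff ℚ xH).mp hx1
    rwa [← e.apply_symm_apply xH, reducedNorm_algEquiv e] at h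
  obtain ⟨hxO, k, hk⟩ := (hΛ x).mp hxΛ'
  -- `det (red x) = 1` forces `k = ± 1`
  obtain ⟨n, hn, hdet⟩ := R.det_red ⟨x, hxO⟩
  have hn1 : n = 1 := by
    have : (n : ℚ) = 1 := by rw [← hn]; exact hnx
    exact_mod_cast this
  rw [hk, Matrix.det_smul, hg, mul_one, Fintype.card_fin, hn1, Int.cast_one, sq, mul_self_eq_one_iff] at hdet
  -- the unit `u = ± x`
  obtain ⟨u, hu, hnu, hred⟩ : ∃ u : X.B, ∃ hu : u ∈ coverOrder X q, reducedNorm ℚ X.B u = 1 ∧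
      R.red ⟨u, hu⟩ = (g : Matrix (Fin 2) (Fin 2) (ZMod q)) := by
    rcases hdet with h1 | h1
    · exact ⟨x, hxO, hnx, by rw [hk, h1, one_smul]⟩
    · refine ⟨-x, (coverOrder X q).neg_mem hxO, ?_, ?_⟩
      · rw [reducedNorm_neg]; exact hnx
      · have : (⟨-x, (coverOrder X q).neg_mem hxO⟩ : coverSubring X q) = -⟨x, hxO⟩ := rfl
        rw [this, map_neg, hk, h1, neg_smul, one_smul, neg_neg]
  obtain ⟨γ, hγ⟩ := exists_coverUnits_of_reducedNorm_eq_one hu hnu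
  refine ⟨γ, Units.ext ?_⟩
  rw [coe_redHom, hγ, hred]

end Summit.BirchSwinnertonDyer.BirchSwinnertonDyer.Theorems.CartanCover.CoverReduction

end
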